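import Literature.MathematicalPhysics.QuantumLattice.YangMillsClassical
import Mathlib.Analysis.Calculus.FDeriv.Symmetric
import HarnessLib

/-!
# Gauge covariance of the curvature and gauge invariance of the Yang–Mills action

Trunk T-QLATTICE / T-AQFT (item G13). Sibling proof file of
`Literature/MathematicalPhysics/QuantumLattice/YangMillsClassical.lean` (next to
`YangMillsClassicalProofs.lean`, pure gauges, and `YangMillsClassicalBianchiProofs.lean`, which it
does not import). It discharges the named facts (D-0014)

* `Literature.MathematicalPhysics.QuantumLattice.curvature_gaugeAct` as `Literature.MathematicalPhysics.QuantumLattice.curvature_gaugeAct_holds`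
  (`F_{g•A}(x)(u,v) = g(x) F_A(x)(u,v) g(x)⁻¹` for `C²` gauge transformations `g : E → 𝔸ˣ` and
  differentiable connections `A`),
* `Literature.MathematicalPhysics.QuantumLattice.ymDensity_gaugeAct` as `Literature.MathematicalPhysics.QuantumLattice.ymDensity_gaugeAct_holds` and
  `Literature.MathematicalPhysics.QuantumLattice.ymAction_gaugeAct` as `Literature.MathematicalPhysics.QuantumLattice.ymAction_gaugeAct_holds` (gauge invariance of the
  Yang–Mills density `∑_{i<j} ‖F(eᵢ,eⱼ)‖²` and of the action `S(A) = ∫ |F_A|²` when `g` acts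
  isometrically by conjugation),
* `Literature.MathematicalPhysics.QuantumLattice.ymAction_gaugeAct_unitaryGroup` as `Literature.MathematicalPhysics.QuantumLattice.ymAction_gaugeAct_unitaryGroup_holds`
  (the case `𝔸 = M_N(ℂ)` with the Frobenius norm and `U(N)`-valued `g`).

No statement is introduced or changed here; the auxiliary lemma `Literature.MathematicalPhysics.QuantumLattice.fderiv_gaugeAct_apply`
is proof infrastructure (a derivative formula, proved).

## Sources

A. Jaffe, E. Witten, *Quantum Yang–Mills theory* (Clay Mathematics Institute Millennium Problem
description, 2000) [cite: JaffeWitten2000], §1, pp. 1–2: the curvature `F = dA + A ∧ A`, the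
Yang–Mills equations `0 = d_A F = d_A * F`, and the Lagrangian (1)
`L = (1/4g²) ∫ Tr F ∧ *F`, "where `Tr` denotes an invariant quadratic form on the Lie algebra of
`G`"; p. 6: "gauge-invariant local polynomials in the curvature `F` and its covariant
derivatives". The text asserts the gauge invariance of (1) without proof; the proof below is the
standard flat-space computation (S. K. Donaldson, P. B. Kronheimer, *The Geometry of
Four-Manifolds* (1990), (2.1.7)–(2.1.8), not held in the literature store, no page numbers quoted).
Unitary invariance of the Frobenius norm: Horn–Johnson, *Matrix Analysis* (2013), Thm 2.2.2,
already discharged in the statement file as `Matrix.frobenius_norm_toUnits_mul_mul_inv_holds`.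

## Proof architecture

Write `a = g(x)`, `b = g(x)⁻¹`, `g_u = (∂ᵤ g)(x)`, so `(g • A)(x)(w) = a A_w b − g_w b`
(`gaugeAct_apply`).
* `fderiv_gaugeAct_apply`: by the Leibniz rule (`HasFDerivAt.mul'`), `d(g⁻¹) = −b (dg) b`
  (chain rule with Mathlib's `hasFDerivAt_ringInverse`, where `[HasSummableGeomSeries 𝔸]`
  enters) and `C²`-differentiability of `dg` (`ContDiff.fderiv_right`):
  `∂ᵤ (g • A)_w = g_u A_w b + a (∂ᵤ A_w) b − a A_w b g_u b − D²g(u,w) b + g_w b g_u b`.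
* `curvature_gaugeAct_holds`: insert this twice into
  `F_{g•A}(u,v) = ∂ᵤ(g•A)_v − ∂ᵥ(g•A)_u + [(g•A)_u, (g•A)_v]`; the Hessian terms cancel by
  symmetry of the second derivative of a `C²` map over `ℝ` (`ContDiffAt.isSymmSndFDerivAt`), the
  products are expanded with `b a = 1` (`Units.inv_mul_cancel_left`), and the twelve inhomogeneous
  monomials cancel pairwise (`abel`), leaving `a (∂ᵤA_v − ∂ᵥA_u + [A_u, A_v]) b`.
* `ymDensity_gaugeAct_holds`, `ymAction_gaugeAct_holds`: termwise `‖a F b‖ = ‖F‖` by the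
  isometry hypothesis, then integrate.
* `ymAction_gaugeAct_unitaryGroup_holds`: specialise to `g = Unitary.toUnits ∘ g₀` with
  `g₀ : E → U(N)`; completeness of `M_N(ℂ)` supplies `HasSummableGeomSeries`, and the isometry
  hypothesis is `Matrix.frobenius_norm_toUnits_mul_mul_inv_holds`.
-/

noncomputable section

open scoped RightActions

namespace Literature.MathematicalPhysics.QuantumLattice

section GaugeCovarianceProofs

variable {E : Type*} [NormedAddCommGroup E] [InnerProductSpace ℝ E]
variable {𝔸 : Type*} [NormedRing 𝔸] [NormedAlgebra ℝ 𝔸]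

/-- Directional derivative of the components of a gauge-transformed connection: for a `C²` gauge
transformation `g` and a differentiable connection `A`,
`∂ᵤ (g • A)_w = (∂ᵤg) A_w g⁻¹ + g (∂ᵤA_w) g⁻¹ − g A_w g⁻¹ (∂ᵤg) g⁻¹ − (∂ᵤ∂_w g) g⁻¹ + (∂_w g) g⁻¹ (∂ᵤg) g⁻¹`
(Leibniz rule with `d(g⁻¹) = −g⁻¹ (dg) g⁻¹`; the calculus step in the proof of
Donaldson–Kronheimer (2.1.8)). [folklore] -/
theorem fderiv_gaugeAct_apply [HasSummableGeomSeries 𝔸] (g : E → 𝔸ˣ) (A : Connection E 𝔸)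
    (hg : ContDiff ℝ 2 fun y => (g y : 𝔸)) (hA : Differentiable ℝ A) (x u w : E) :
    fderiv ℝ (fun y => gaugeAct g A y w) x u =
      fderiv ℝ (fun y => (g y : 𝔸)) x u * A x w * ((g x)⁻¹ : 𝔸ˣ)
      + (g x : 𝔸) * fderiv ℝ (fun y => A y w) x u * ((g x)⁻¹ : 𝔸ˣ)
      - (g x : 𝔸) * A x w * (((g x)⁻¹ : 𝔸ˣ) * fderiv ℝ (fun y => (g y : 𝔸)) x u * ((g x)⁻¹ : 𝔸ˣ))
      - (fderiv ℝ (fderiv ℝ fun y => (g y : 𝔸)) x u w * ((g x)⁻¹ : 𝔸ˣ)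
         - fderiv ℝ (fun y => (g y : 𝔸)) x w *
            (((g x)⁻¹ : 𝔸ˣ) * fderiv ℝ (fun y => (g y : 𝔸)) x u * ((g x)⁻¹ : 𝔸ˣ))) := by
  have hGdiff : Differentiable ℝ (fun y => (g y : 𝔸)) := hg.differentiable (by simp)
  have hdGdiff : Differentiable ℝ (fderiv ℝ fun y => (g y : 𝔸)) :=
    (hg.fderiv_right (m := 1) le_rfl).differentiable (by simp)
  have h1 := (hGdiff x).hasFDerivAt
  have h2 : HasFDerivAt (fun y => A y w) (fderiv ℝ (fun y => A y w) x) x :=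
    ((hA x).clm_apply (differentiableAt_const w)).hasFDerivAt
  -- `d(g⁻¹) = -g⁻¹ (dg) g⁻¹`: chain rule with `hasFDerivAt_ringInverse`
  have h3 : HasFDerivAt (fun y => (((g y)⁻¹ : 𝔸ˣ) : 𝔸))
      (-((ContinuousLinearMap.mulLeftRight ℝ 𝔸 ((g x)⁻¹ : 𝔸ˣ) ((g x)⁻¹ : 𝔸ˣ)).comp
        (fderiv ℝ (fun y => (g y : 𝔸)) x))) x := by
    have := (hasFDerivAt_ringInverse (𝕜 := ℝ) (g x)).comp x h1
    simpa [Function.comp_def] using this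
  have h4 : HasFDerivAt (fun y => fderiv ℝ (fun y => (g y : 𝔸)) y w)
      ((fderiv ℝ (fderiv ℝ fun y => (g y : 𝔸)) x).flip w) x := by
    have := (hdGdiff x).hasFDerivAt.clm_apply (hasFDerivAt_const w x)
    simpa using this
  have h5 := ((h1.fun_mul' h2).fun_mul' h3).fun_sub (h4.fun_mul' h3)
  have hfun : (fun y => gaugeAct g A y w) = fun y =>
      (g y : 𝔸) * A y w * ((g y)⁻¹ : 𝔸ˣ) - fderiv ℝ (fun y => (g y : 𝔸)) y w * ((g y)⁻¹ : 𝔸ˣ) := by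
    funext y; exact gaugeAct_apply g A y w
  rw [hfun, h5.fderiv]
  simp [mul_assoc]
  abel

/-- Discharge of the named fact `curvature_gaugeAct`: the curvature transforms in the adjoint
representation, `F_{g • A}(x)(u,v) = g(x) F_A(x)(u,v) g(x)⁻¹`, for `C²` gauge transformations `g`
and differentiable connections `A`. Expand with `fderiv_gaugeAct_apply`; the second-derivative
terms cancel by symmetry of the Hessian of `g` (`ContDiffAt.isSymmSndFDerivAt`) and the remaining
inhomogeneous terms cancel pairwise using `g⁻¹ g = 1`. Jaffe–Witten (2000) §1 (`F = dA + A ∧ A`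
and its gauge covariance, implicit in "invariant quadratic form"); Donaldson–Kronheimer (2.1.8).
[cite: JaffeWitten2000, §1] -/
theorem curvature_gaugeAct_holds [HasSummableGeomSeries 𝔸] :
    curvature_gaugeAct (E := E) (𝔸 := 𝔸) := by
  intro g A hg hA x u v
  have hsymm : fderiv ℝ (fderiv ℝ fun y => (g y : 𝔸)) x u v =
      fderiv ℝ (fderiv ℝ fun y => (g y : 𝔸)) x v u :=
    hg.contDiffAt.isSymmSndFDerivAt (by simp [minSmoothness_of_isRCLikeNormedField]) u v
  simp only [curvature]
  rw [fderiv_gaugeAct_apply g A hg hA x u v, fderiv_gaugeAct_apply g A hg hA x v u, hsymm]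
  simp only [gaugeAct_apply, Ring.lie_def]
  simp only [mul_sub, sub_mul, mul_add, add_mul, mul_assoc, Units.inv_mul_cancel_left]
  abel

variable [FiniteDimensional ℝ E]

/-- Discharge of the named fact `ymDensity_gaugeAct`: the Yang–Mills density
`∑_{i<j} ‖F(eᵢ,eⱼ)‖²` is gauge invariant when `g` acts isometrically by conjugation, since
`F_{g•A} = g F_A g⁻¹` termwise (`curvature_gaugeAct_holds`). Jaffe–Witten (2000) §1, eq. (1)
("`Tr` denotes an invariant quadratic form on the Lie algebra of `G`").
[cite: JaffeWitten2000, §1 eq. (1)] -/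
theorem ymDensity_gaugeAct_holds : ymDensity_gaugeAct (E := E) (𝔸 := 𝔸) := by
  intro _ g A hg hA hiso x
  simp [ymDensity, ymDensityOfBasis, curvature_gaugeAct_holds g A hg hA, hiso]

variable [MeasurableSpace E] [BorelSpace E]

/-- Discharge of the named fact `ymAction_gaugeAct`: gauge invariance of the Yang–Mills action,
`S(g • A) = S(A)`, when `g` acts isometrically by conjugation (the densities agree pointwise,
`ymDensity_gaugeAct_holds`). Jaffe–Witten (2000) §1, eq. (1), and p. 6 ("gauge-invariant local
polynomials in the curvature"). [cite: JaffeWitten2000, §1 eq. (1)] -/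
theorem ymAction_gaugeAct_holds : ymAction_gaugeAct (E := E) (𝔸 := 𝔸) := by
  intro _ g A hg hA hiso
  simp [ymAction, ymDensity_gaugeAct_holds g A hg hA hiso]

end GaugeCovarianceProofs

section MatrixGaugeProofs

open scoped Matrix.Norms.Frobenius

variable {E : Type*} [NormedAddCommGroup E] [InnerProductSpace ℝ E] [FiniteDimensional ℝ E]
  [MeasurableSpace E] [BorelSpace E] {N : ℕ}

/-- Discharge of the named fact `ymAction_gaugeAct_unitaryGroup`: for `U(N)`-valued `C²` gauge
transformations and the Frobenius (Hilbert–Schmidt) norm on `M_N(ℂ)`, `S(g • A) = S(A)`. From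
`ymAction_gaugeAct_holds` and the unitary invariance of the Frobenius norm
(`Matrix.frobenius_norm_toUnits_mul_mul_inv_holds`, Horn–Johnson Thm 2.2.2). Jaffe–Witten (2000)
§1, eq. (1), with compact `G ⊆ U(N)` and `Tr` the invariant form `(a, b) ↦ Re tr (a* b)`.
[cite: JaffeWitten2000, §1 eq. (1)] -/
theorem ymAction_gaugeAct_unitaryGroup_holds :
    ymAction_gaugeAct_unitaryGroup (E := E) (N := N) :=
  fun g A hg hA => ymAction_gaugeAct_holds _ A hg hA fun x a =>
    Matrix.frobenius_norm_toUnits_mul_mul_inv_holds (g x) a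

end MatrixGaugeProofs

end Literature.MathematicalPhysics.QuantumLattice
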